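/-
Copyright (c) 2026 the pub-hodgecm-mathlib formalisation cell (harness21).  Prover seat hodgecm-mathlib-A-p16 (g33): road «S3-ram» (LEAD F0P3a-plan (g13); owner lineage
F0P3a-p06), the (Cnt2′) BLOCK-LAW skeleton (keeper F0P3a-p06 (g16) v2.1, chair F0P3a-p07 (g15) RULINGS (13)(6), (14)(1)): composition pen `stub_Zaniso`, FILE Z6 — THE
REGIME-B ANISOTROPIC CELLS, ROW `0`, CLOSED; 2026-09-02.
-/
import Literature.NumberTheory.Rogawski1990.DepthZeroKappaTransferTypeTwoRamifiedAnisotropicTotalsOdd      -- ★ p849189 (this seat): `anisotropicTotal_zero_ram_of_census_odd` + §1; brings the CM dress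
import Literature.NumberTheory.Automorphic.UnitaryLatticeTreeAnisotropicRootOddDepthLabels                   -- ★ p849421 (F0P2-p01 (g17)): (K2-odd) «regime-B anisotropic root: E = ∅, one class», `anisotropicRoot_odd_census_of_coe_eq_conj_endoGL_of_nonsquare`; brings ★ p849270∕p849286 (`ncard_rootGrandchildren_eq_of_congr_sq`)
import Literature.NumberTheory.Automorphic.UnitaryLatticeTreeFramesOfInvolution                             -- ★ `isTree_latticeGraph_three_of_neg`
import Literature.NumberTheory.Automorphic.UnitaryLatticeTreeLevelShift                                     -- ★ `map_sub_one_latt_le_scaleLattice_iff`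
import HarnessLib

/-!
# The ramified `κ`-orbital integral, type (2): THE REGIME-B ANISOTROPIC CELLS OF THE BLOCK-LAW SKELETON, ROW `0` — `#B = 1 + (q+1)q·S(P_k)₀`
# (Rogawski 1990 §4.9; Kottwitz 1986 §3; Bruhat–Tits 1972 §10)

Topic `NumberTheory/Rogawski1990`; namespace `Literature.NumberTheory.Rogawski1990.BlockLawAniso`.  THEOREMS ONLY (no definition, no instance, no notation, no named fact,
no `sorry`); kernel lane `--supports stmt-HodgeConjecture-24833`.  Cell `pub/hodgecm-mathlib` (D-0151), crux H413; road «S3-ram» (Literature seeding, count-neutral); the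
(Cnt2′) BLOCK-LAW skeleton of keeper F0P3a-p06 (g16), v2.1∕v2.2 (`F0/P3a/F0P3a-p06/g16/blocklaw/v2_1/`, zero texts unchanged in v2.2): **`zaniso_zero_odd_B_ram` and
`zaniso_zero_even_B_ram` = the keeper's cells `stub_Zaniso_zero_odd_B` ∕ `stub_Zaniso_zero_even_B` VERBATIM** (v2.1 texts with the ref5 R-438 guard `m < N`; only the three idle
frame binders renamed `_hH' _hA _hframe`, positions unchanged), CLOSED — so the keeper writes `stub_Zaniso_zero_{odd,even}_B := zaniso_zero_{odd,even}_B_ram L H' hH' w hw he hH'w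
_hH'i h2 ϖ hϖ hσϖ A hA hframe`.

THE COMPOSITION ([Rogawski1990] §4.9; [Kottwitz1986] §3).  Regime B: `m = 2k + 3 < N` (the `u`-line is shallower than the centre of the block).  The anisotropic literal
`Y = P₁·ι(γ₁, u_w)·P₁⁻¹` is centred to `γ′ = P₁·ι(s·γ₁, 1)·P₁⁻¹`; its row-`0` total is ★ `anisotropicTotal_zero_ram_of_census_odd` (this seat, p849189) in the collar atoms
`(NE, NP, NM)` AT `γ′`; (K2-odd) ★ `anisotropicRoot_odd_census_of_coe_eq_conj_endoGL_of_nonsquare` (F0P2-p01 (g17), p849421) says `NE = 0` and `{NP, NM} = {0, #GC}` according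
to the orientation class — so `NP + NM = #GC = (q+1)·q` (★ p849286) either way; its inputs at `γ′`: `Odd m`, `3 ≤ m`, `‖s·γ₁ − 1‖ ≤ |ϖ|^m` (conformality), the REGIME-B MARKER
`|disc γ₁| < |ϖ|^{2m}` (from `|disc γ₁| = |ϖ|^{2N}` and the guard `m < N`) and the centre depth `|tr(s·γ₁) − 2| = |ϖ|^m` (§0: `(tr − 2u)² = 4·det(γ₁ − u·1) + disc`).
HONEST LABEL: HC_CM is proved only modulo the 2 remaining named inputs (hLiu418 24832, h413 24833) until rung 0 closes; nothing printed is asserted here (composition of ★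
theorems); «S3-ram» has no books consequence.

## References
* [Rogawski1990] J. D. Rogawski, *Automorphic Representations of Unitary Groups in Three Variables*, Ann. of Math. Stud. 123 (1990), §4.9 Prop. 4.9.1 (a) p. 55, Lemma 4.9.3.
* [Kottwitz1986] R. E. Kottwitz, *Base change for unit elements of Hecke algebras*, Compositio Math. 60 (1986), §3.
* [BruhatTits1972] F. Bruhat, J. Tits, *Groupes réductifs sur un corps local I*, Publ. Math. IHÉS 41 (1972), §10.
-/

set_option autoImplicit false

noncomputable section

open NumberField IsDedekindDomain Matrix Polynomial ValuativeRel
open Literature.NumberTheory.Automorphic Literature.NumberTheory.Automorphic.UnitaryGroup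
open Literature.NumberTheory.Automorphic.UnitaryLatticeTree Literature.NumberTheory.Automorphic.HermitianLattice
open Literature.NumberTheory.GaloisRepresentations
open Literature.NumberTheory.Rogawski1990 Literature.NumberTheory.Rogawski1990.TypeOneRamifiedJunction
open scoped Matrix MatrixGroups ValuativeRel WithZero

/-! ## §0 The centre of the block is as deep as the root in regime B -/

namespace Literature.NumberTheory.Automorphic.UnitaryLatticeTree

variable {K : Type*} [Field K] [Valued K ℤᵐ⁰]

/-- In `ℤᵐ⁰`: `x·x = y·y ⇒ x = y`. [folklore] -/
private theorem eq_of_mul_self_eq_mul_self_withZero {x y : ℤᵐ⁰} (h : x * x = y * y) : x = y := by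
  rcases lt_trichotomy x y with hlt | heq | hgt
  · exact absurd h (ne_of_lt (lt_of_le_of_lt (mul_le_mul' le_rfl hlt.le) (mul_lt_mul_of_pos_right hlt (lt_of_le_of_lt zero_le hlt))))
  · exact heq
  · exact absurd h.symm (ne_of_lt (lt_of_le_of_lt (mul_le_mul' le_rfl hgt.le) (mul_lt_mul_of_pos_right hgt (lt_of_le_of_lt zero_le hgt))))

/-- **THE CENTRE IS AS DEEP AS THE ROOT IN REGIME B**: for a `2 × 2` matrix `A` and a scalar `u` with `|det(A − u·1)| = μ²` and `|tr² A − 4 det A| < μ²` (the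
traceless part is deeper), `|tr A − 2u| = μ` — since `(tr A − 2u)² = 4·det(A − u·1) + (tr² A − 4 det A)` and `|4| = 1`. [cite: Kottwitz1986, §3] [cite: Rogawski1990, §4.9 p. 55] -/
theorem v_trace_sub_two_mul_eq_of_v_det_sub_smul_one_eq_of_disc_lt (h2 : Valued.v (2 : K) = 1) (A : Matrix (Fin 2) (Fin 2) K) (u : K) {μ : ℤᵐ⁰}
    (hdet : Valued.v (A - u • (1 : Matrix (Fin 2) (Fin 2) K)).det = μ * μ) (hdisc : Valued.v (A.trace ^ 2 - 4 * A.det) < μ * μ) :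
    Valued.v (A.trace - 2 * u) = μ := by
  have h4 : Valued.v (4 : K) = 1 := by rw [show (4 : K) = 2 * 2 by norm_num, map_mul, h2, one_mul]
  have hid : (A.trace - 2 * u) ^ 2 = 4 * (A - u • (1 : Matrix (Fin 2) (Fin 2) K)).det + (A.trace ^ 2 - 4 * A.det) := by
    rw [← eval_charpoly_fin_two_eq_det_sub_smul_one, Matrix.eval_charpoly, Matrix.det_fin_two, Matrix.det_fin_two, Matrix.trace_fin_two]
    simp [Matrix.scalar_apply]
    ring
  have hsq : Valued.v ((A.trace - 2 * u) ^ 2) = μ * μ := by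
    rw [hid]
    have h4d : Valued.v (4 * (A - u • (1 : Matrix (Fin 2) (Fin 2) K)).det) = μ * μ := by rw [map_mul, h4, one_mul, hdet]
    rw [← h4d] at hdisc ⊢
    exact Valuation.map_add_eq_of_lt_left _ hdisc
  rw [map_pow, pow_two] at hsq
  exact eq_of_mul_self_eq_mul_self_withZero hsq

end Literature.NumberTheory.Automorphic.UnitaryLatticeTree

/-! ## §1 The two regime-B row-`0` cells -/

namespace Literature.NumberTheory.Rogawski1990.BlockLawAniso

set_option maxHeartbeats 1600000 in
-- budget only: the keeper's statement-heavy socket telescope (verbatim); the proof is a composition of ★ heads.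
/-- **THE KEEPER'S CELL `stub_Zaniso_zero_odd_B`, CLOSED** (regime B, row `0`, anisotropic literal, `N` odd): `∀ k a, m = 2k+3 → n = a+k+1 →
m < N → ∃ Na, (#B : ℂ) = 1 + Na·Σ_{i<k} q^{2i} ∧ Na = (q+1)·q` — ★ p849189 (this seat) ∘ ★ p849421 (F0P2-p01 (g17)) ∘ ★ p849286 at the centred literal `γ′`.
[cite: Rogawski1990, §4.9 Prop. 4.9.1 (a) p. 55, Lemma 4.9.3] [cite: Kottwitz1986, §3] [cite: BruhatTits1972, §10] -/
theorem zaniso_zero_odd_B_ram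
    (L : Type) [Field L] [NumberField L] [IsCMField L] (H' : Matrix (Fin 3) (Fin 3) L)
    {v : HeightOneSpectrum (𝓞 ↥(maximalRealSubfield L))}
    (_hH' : (H'.map (cmConjRingHom L)).transpose = H') (w : PlacesOver L v)
    (hw : IsCMField.complexConj L • w.1 = w.1) (he : v.asIdeal.ramificationIdx' w.1.asIdeal ≠ 1)
    (hH'w : IsUnit (placeForm H' w.1)) (_hH'i : hH'w.unit ∈ glInt 3 (w.1.adicCompletion L))
    (h2 : IsUnit (2 : 𝒪[(w.1.adicCompletion L)]))
    (ϖ : w.1.adicCompletion L) (hϖ : Valued.v ϖ = WithZero.exp (-1 : ℤ)) (hσϖ : galAdicCompletionMap (L := L) (IsCMField.complexConj L) hw ϖ = -ϖ)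
    (A : GL (Fin 3) (w.1.adicCompletion L)) (_hA : A ∈ glInt 3 (w.1.adicCompletion L))
    (_hframe : placeForm H' w.1 = (-(placeForm H' w.1).det) • formCongr (galAdicCompletionMap (L := L) (IsCMField.complexConj L) hw) A ((StdForm.antidiagonal 3).over (w.1.adicCompletion L))) :

    ∀ ⦃γH : ((cmDatum L 2 (Matrix.of fun i j : Fin 2 => if i.val + j.val + 1 = 2 then (1 : L) else 0)).Local v × (cmDatum L 1 (Matrix.of fun i j : Fin 1 => if i.val + j.val + 1 = 1 then (1 : L) else 0)).Local v)⦄,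
      (∀ i j : Fin 2, Valued.v (((((γH.1.val : GL (Fin 2) (UnitaryGroup.LocalRing L v)).val.map (Pi.evalRingHom (fun w' : PlacesOver L v => w'.1.adicCompletion L) w))) - 1) i j) ≤ Valued.v (ϖ ^ 2)) → Valued.v (finGammaTwo L v γH w - 1) ≤ Valued.v (ϖ ^ 2) → IsLocalGRegular L v γH →
      (¬ ∃ x : (w.1.adicCompletion L), ((((γH.1.val : GL (Fin 2) (UnitaryGroup.LocalRing L v)).val.map (Pi.evalRingHom (fun w' : PlacesOver L v => w'.1.adicCompletion L) w))).charpoly).IsRoot x) → ∀ ⦃n : ℕ⦄,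
      Valued.v ((((γH.1.val : GL (Fin 2) (UnitaryGroup.LocalRing L v)).val.map (Pi.evalRingHom (fun w' : PlacesOver L v => w'.1.adicCompletion L) w))).trace ^ 2 - 4 * (((γH.1.val : GL (Fin 2) (UnitaryGroup.LocalRing L v)).val.map (Pi.evalRingHom (fun w' : PlacesOver L v => w'.1.adicCompletion L) w))).det) = WithZero.exp (-((2 * (2 * n + 1) : ℕ) : ℤ)) → 1 ≤ n →
      ∀ (m : ℕ), Valued.v (((finCharpolyTwo L v γH).eval (finGammaTwo L v γH)) w) =
          Valued.v ((toPlace v w (HeckeCharacter.uniformizer ↥(maximalRealSubfield L) v : v.adicCompletion ↥(maximalRealSubfield L))) ^ m) →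
        ∀ β : (v.adicCompletion ↥(maximalRealSubfield L))ˣ, toPlace v w (β : v.adicCompletion ↥(maximalRealSubfield L)) =
          -(((finCharpolyTwo L v γH).eval (finGammaTwo L v γH)) w *
              (finGammaTwo L v γH w ^ 2 +
                ((γH.1.val.val : Matrix (Fin 2) (Fin 2) (LocalRing L v)).map (Pi.evalRingHom (fun w' : PlacesOver L v => w'.1.adicCompletion L) w)).det)) /
            (2 * finGammaTwo L v γH w ^ 2 *
              ((γH.1.val.val : Matrix (Fin 2) (Fin 2) (LocalRing L v)).map (Pi.evalRingHom (fun w' : PlacesOver L v => w'.1.adicCompletion L) w)).det) →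
        ∀ (P₁ : GL (Fin 3) (w.1.adicCompletion L)) (d : Fin 2 → (w.1.adicCompletion L)) (η : (w.1.adicCompletion L)) (γ₁ : GL (Fin 2) (w.1.adicCompletion L)),
        P₁ ∈ glInt 3 (w.1.adicCompletion L) →
        formCongr (galAdicCompletionMap (L := L) (IsCMField.complexConj L) hw) P₁ (placeForm (Matrix.of fun i j : Fin 3 => if i.val + j.val + 1 = 3 then (1 : L) else 0) w.1) = !![(Matrix.diagonal d) 0 0, 0, (Matrix.diagonal d) 0 1; 0, η, 0; (Matrix.diagonal d) 1 0, 0, (Matrix.diagonal d) 1 1] →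
        (∀ i, Valued.v (d i) = 1) → (∀ i, (galAdicCompletionMap (L := L) (IsCMField.complexConj L) hw) (d i) = d i) →
        (∀ z : (w.1.adicCompletion L), Valued.v z ≤ 1 → Valued.v (d 0 + d 1 * ((galAdicCompletionMap (L := L) (IsCMField.complexConj L) hw) z * z)) = 1) →
        (∀ z : (w.1.adicCompletion L), Valued.v z ≤ 1 → Valued.v (d 0 * ((galAdicCompletionMap (L := L) (IsCMField.complexConj L) hw) z * z) + d 1) = 1) →
        (galAdicCompletionMap (L := L) (IsCMField.complexConj L) hw) η = η → Valued.v η = 1 →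
        (∀ i j, Valued.v (((γ₁ : Matrix (Fin 2) (Fin 2) (w.1.adicCompletion L)) - 1) i j) ≤ Valued.v (ϖ ^ 2)) →
        γ₁ ∈ unitaryGroupOfForm (galAdicCompletionMap (L := L) (IsCMField.complexConj L) hw) (Matrix.diagonal d) →
        (γ₁ : Matrix (Fin 2) (Fin 2) (w.1.adicCompletion L)).charpoly = (((γH.1.val : GL (Fin 2) (UnitaryGroup.LocalRing L v)).val.map (Pi.evalRingHom (fun w' : PlacesOver L v => w'.1.adicCompletion L) w))).charpoly →
        Valued.v ((γ₁ : Matrix (Fin 2) (Fin 2) (w.1.adicCompletion L)).trace ^ 2 - 4 * (γ₁ : Matrix (Fin 2) (Fin 2) (w.1.adicCompletion L)).det) = WithZero.exp (-((2 * (2 * n + 1) : ℕ) : ℤ)) →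
        (¬ ∃ x : (w.1.adicCompletion L), ((γ₁ : Matrix (Fin 2) (Fin 2) (w.1.adicCompletion L)).charpoly).IsRoot x) →
        (¬ ∃ t : (w.1.adicCompletion L), t * (galAdicCompletionMap (L := L) (IsCMField.complexConj L) hw) t = η) →
          ∀ (k a : ℕ), m = 2 * k + 3 → n = a + k + 1 → m < 2 * n + 1 → ∃ (Na : ℕ),
          ({M : Submodule (Valued.integer (w.1.adicCompletion L)) (Fin 3 → (w.1.adicCompletion L)) | IsSelfDualLattice (galAdicCompletionMap (L := L) (IsCMField.complexConj L) hw) ϖ (placeForm (Matrix.of fun i j : Fin 3 => if i.val + j.val + 1 = 3 then (1 : L) else 0) w.1) M ∧ mapGL (P₁ * endoGL (γ₁, ((localNonsplitEquiv (IsCMField.complexConj L) (Matrix.of fun i j : Fin 1 => if i.val + j.val + 1 = 1 then (1 : L) else 0) (IsCMField.complexConj_ne_one L) w hw γH.2).val : GL (Fin 1) (w.1.adicCompletion L))) * P₁⁻¹) M = M ∧ M.map ((Matrix.toLin' (((P₁ * endoGL (γ₁, ((localNonsplitEquiv (IsCMField.complexConj L) (Matrix.of fun i j : Fin 1 => if i.val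 + j.val + 1 = 1 then (1 : L) else 0) (IsCMField.complexConj_ne_one L) w hw γH.2).val : GL (Fin 1) (w.1.adicCompletion L))) * P₁⁻¹ : GL (Fin 3) (w.1.adicCompletion L)) : Matrix (Fin 3) (Fin 3) (w.1.adicCompletion L)) - 1)).restrictScalars (Valued.integer (w.1.adicCompletion L))) ≤ scaleLattice (ϖ ^ 2) M}.ncard : ℂ) =
            1 + (Na : ℂ) * ∑ i ∈ Finset.range k, (Ideal.absNorm v.asIdeal : ℂ) ^ (2 * i) ∧ (Na : ℂ) = ((Ideal.absNorm v.asIdeal : ℂ) + 1) * (Ideal.absNorm v.asIdeal : ℂ) := by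
  intro γH _hblk hu2 _hreg _hirr n _hdisc _hn m hm β _hβ P₁ d η γ₁ hP₁ hform hd hσd han₀ han₁ hση hηv hγ2 hγU hχ hdiscγ hirrγ hηN k a hmk _hna hlt
  classical
  have hmA : m = 2 * k + 3 := hmk
  -- THE CM DRESS
  have hc1 : IsCMField.complexConj L ≠ 1 := IsCMField.complexConj_ne_one L
  have h2v : Valued.v (2 : (w.1.adicCompletion L)) = 1 := (isUnit_two_integer_iff_valued_eq_one L w.1).1 h2
  have hσσ : ∀ z : (w.1.adicCompletion L), (galAdicCompletionMap (L := L) (IsCMField.complexConj L) hw) ((galAdicCompletionMap (L := L) (IsCMField.complexConj L) hw) z) = z :=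
    galAdicCompletionMap_galAdicCompletionMap_of_smul_eq (IsCMField.complexConj L) w hc1 hw
  have hvσ : ∀ z : (w.1.adicCompletion L), Valued.v ((galAdicCompletionMap (L := L) (IsCMField.complexConj L) hw) z) = Valued.v z := fun z =>
    valued_galAdicCompletionMap (L := L) (IsCMField.complexConj L) hw z
  obtain ⟨-, -, -, hres, hnorm⟩ := ramifiedBlock_adicCompletion L v w hw he h2v
  haveI : Fintype (Valued.ResidueField (w.1.adicCompletion L)) := Fintype.ofFinite _
  haveI := isPrincipalIdealRing_integer_adicCompletion L v w
  have hqN : (Nat.card (Valued.ResidueField (w.1.adicCompletion L)) : ℂ) = (Ideal.absNorm v.asIdeal : ℂ) := by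
    congr 1
    rw [← natCard_residueField_eq_of_compatible, natCard_residueField_eq_of_ramified (IsCMField.complexConj L) v hc1 w hw he, Ideal.absNorm_apply, Submodule.cardQuot_apply]
  have hsq : ∀ t : (w.1.adicCompletion L), Valued.v (t - 1) < 1 → IsSquare t := fun t ht => by
    obtain ⟨r, hr, -⟩ := exists_sq_eq_of_valued_sub_one_lt w.1 h2v t ht
    exact ⟨r, by rw [← hr, sq]⟩
  have hε := valued_sq_sub_eq_one_of_not_exists_norm hσσ hvσ hres hnorm hση hηv hηN
  have hϖ0 : ϖ ≠ 0 := fun h0 => by rw [h0, Valuation.map_zero] at hϖ; exact WithZero.exp_ne_zero hϖ.symm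
  have hϖ2 : Valued.v (ϖ ^ 2) = Valued.v ϖ ^ 2 := map_pow _ _ _
  have hϖlt : Valued.v ϖ < 1 := by rw [hϖ, ← WithZero.exp_zero]; exact WithZero.exp_lt_exp.2 (by norm_num)
  have hT := isTree_latticeGraph_three_of_neg hσσ hvσ hϖ hσϖ hres h2v hnorm
  -- the middle eigenvalue and the centring unit
  have hu00 : ((((localNonsplitEquiv (IsCMField.complexConj L) (Matrix.of fun i j : Fin 1 => if i.val + j.val + 1 = 1 then (1 : L) else 0) (IsCMField.complexConj_ne_one L) w hw γH.2).val : GL (Fin 1) (w.1.adicCompletion L))) : Matrix (Fin 1) (Fin 1) (w.1.adicCompletion L)) 0 0 = finGammaTwo L v γH w := rfl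
  obtain ⟨s, hs'⟩ := exists_units_mul_oneByOne_eq_one (((localNonsplitEquiv (IsCMField.complexConj L) (Matrix.of fun i j : Fin 1 => if i.val + j.val + 1 = 1 then (1 : L) else 0) (IsCMField.complexConj_ne_one L) w hw γH.2).val : GL (Fin 1) (w.1.adicCompletion L)))
  have hs : (s : (w.1.adicCompletion L)) * finGammaTwo L v γH w = 1 := by rw [← hu00]; exact hs'
  have huu : (galAdicCompletionMap (L := L) (IsCMField.complexConj L) hw) (finGammaTwo L v γH w) * finGammaTwo L v γH w = 1 := by
    have h := congrArg (fun y : LocalRing L v => y w) (conjLocal_finGammaTwo_mul_finGammaTwo L v γH)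
    simpa only [Pi.mul_apply, Pi.one_apply, conjLocal_apply_eq_galAdicCompletionMap L v w hw] using h
  have huv : Valued.v (finGammaTwo L v γH w) = 1 := v_eq_one_of_mul_map_eq_one hvσ (by rw [mul_comm]; exact huu)
  have hu2' : Valued.v (finGammaTwo L v γH w - 1) ≤ Valued.v ϖ ^ 2 := by rw [← hϖ2]; exact hu2
  have hsnorm : (galAdicCompletionMap (L := L) (IsCMField.complexConj L) hw) (s : (w.1.adicCompletion L)) * (s : (w.1.adicCompletion L)) = 1 :=
    norm_eq_one_of_mul_eq_one_of_norm_eq_one huu hs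
  obtain ⟨hsv, -⟩ := v_eq_one_and_v_sub_one_le_of_mul_eq_one huv hu2' hs
  -- the frame and the centred literal
  have hform' : formCongr (galAdicCompletionMap (L := L) (IsCMField.complexConj L) hw) P₁ ((StdForm.antidiagonal 3).over (w.1.adicCompletion L)) =
      !![(Matrix.diagonal d) 0 0, 0, (Matrix.diagonal d) 0 1; 0, η, 0; (Matrix.diagonal d) 1 0, 0, (Matrix.diagonal d) 1 1] := by
    rw [← placeForm_antidiagOne]; exact hform
  obtain ⟨hPint, hPinv⟩ := isIntMatrix_and_isIntMatrix_inv_of_mem_glInt hP₁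
  have hP0 : mapGL P₁ (stdLattice (w.1.adicCompletion L) 3) = stdLattice (w.1.adicCompletion L) 3 := (mapGL_stdLattice_eq_iff P₁).2 ⟨hPint, hPinv⟩
  let γ' : unitaryGroupOfForm (galAdicCompletionMap (L := L) (IsCMField.complexConj L) hw) ((StdForm.antidiagonal 3).over (w.1.adicCompletion L)) :=
    ⟨P₁ * endoGL (Matrix.GeneralLinearGroup.scalar (Fin 2) s * γ₁, (1 : GL (Fin 1) (w.1.adicCompletion L))) * P₁⁻¹,
      conj_endoGL_centred_mem_unitaryGroupOfForm_of_formCongr_eq hform' hγU s hsnorm⟩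
  have hγ' : (γ' : GL (Fin 3) (w.1.adicCompletion L)) = P₁ * endoGL (Matrix.GeneralLinearGroup.scalar (Fin 2) s * γ₁, (1 : GL (Fin 1) (w.1.adicCompletion L))) * P₁⁻¹ := rfl
  -- the block: depth `m` from the socket
  have hU : (((γ₁ : Matrix (Fin 2) (Fin 2) (w.1.adicCompletion L))).map (galAdicCompletionMap (L := L) (IsCMField.complexConj L) hw))ᵀ * Matrix.diagonal d *
      (γ₁ : Matrix (Fin 2) (Fin 2) (w.1.adicCompletion L)) = Matrix.diagonal d := hγU
  have hirr' : ∀ x : (w.1.adicCompletion L), ¬ ((γ₁ : Matrix (Fin 2) (Fin 2) (w.1.adicCompletion L)).charpoly).IsRoot x := fun x hx => hirrγ ⟨x, hx⟩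
  have hdet := valued_det_sub_smul_one_eq_of_tokens L w hw he ϖ hϖ γH m hm γ₁ hχ
  have hmm : Valued.v ϖ ^ (2 * m) = Valued.v ϖ ^ m * Valued.v ϖ ^ m := by rw [two_mul, pow_add]
  have hγd : ∀ i j, Valued.v (((γ₁ : Matrix (Fin 2) (Fin 2) (w.1.adicCompletion L)) - finGammaTwo L v γH w • (1 : Matrix (Fin 2) (Fin 2) (w.1.adicCompletion L))) i j) ≤ Valued.v ϖ ^ m :=
    forall_valued_sub_smul_one_apply_le_of_valued_det_le hvσ h2v hsq hd han₀ han₁ hU hirr' _ (by rw [← hu00, hdet, hmm])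
  have hcoe : ((Matrix.GeneralLinearGroup.scalar (Fin 2) s * γ₁ : GL (Fin 2) (w.1.adicCompletion L)) : Matrix (Fin 2) (Fin 2) (w.1.adicCompletion L)) =
      (s : (w.1.adicCompletion L)) • (γ₁ : Matrix (Fin 2) (Fin 2) (w.1.adicCompletion L)) := coe_scalar_mul_two_eq_smul s γ₁
  have hBm : ∀ i j, Valued.v ((((Matrix.GeneralLinearGroup.scalar (Fin 2) s * γ₁ : GL (Fin 2) (w.1.adicCompletion L)) : Matrix (Fin 2) (Fin 2) (w.1.adicCompletion L)) - 1) i j) ≤ Valued.v ϖ ^ m := fun i j => by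
    rw [hcoe, v_smul_sub_one_apply_eq_of_mul_eq_one _ hs hsv]; exact hγd i j
  have hγ₁int : ∀ i j, Valued.v ((γ₁ : Matrix (Fin 2) (Fin 2) (w.1.adicCompletion L)) i j) ≤ 1 :=
    isIntMatrix_of_forall_v_sub_one_le_of_lt_one (C := Valued.v (ϖ ^ 2)) (by rw [hϖ2]; exact pow_lt_one₀ zero_le hϖlt two_ne_zero) hγ2
  have hγint : ∀ i j, Valued.v (((Matrix.GeneralLinearGroup.scalar (Fin 2) s * γ₁ : GL (Fin 2) (w.1.adicCompletion L)) : Matrix (Fin 2) (Fin 2) (w.1.adicCompletion L)) i j) ≤ 1 := by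
    rw [hcoe]; exact forall_v_smul_apply_le_one hsv.le hγ₁int
  have hγU' := scalar_mul_mem_unitaryGroupOfForm hγU s hsnorm
  have hirr'' : ∀ x : (w.1.adicCompletion L), ¬ (((Matrix.GeneralLinearGroup.scalar (Fin 2) s * γ₁ : GL (Fin 2) (w.1.adicCompletion L)) : Matrix (Fin 2) (Fin 2) (w.1.adicCompletion L)).charpoly).IsRoot x := by
    rw [hcoe]; exact forall_not_isRoot_charpoly_smul (Units.ne_zero s) hirr'
  have hm3 : 3 ≤ m := by omega
  have hm2 : 2 ≤ m := by omega
  have hlt1 : Valued.v ϖ ^ m < 1 := pow_lt_one₀ zero_le hϖlt (by omega)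
  have hγ'0 : γ' ∈ unitaryInt (galAdicCompletionMap (L := L) (IsCMField.complexConj L) hw) ((StdForm.antidiagonal 3).over (w.1.adicCompletion L)) := by
    have h1 : IsIntMatrix (((γ' : GL (Fin 3) (w.1.adicCompletion L)) : Matrix (Fin 3) (Fin 3) (w.1.adicCompletion L))) := by
      rw [hγ']; exact isIntMatrix_coe_conj_endoGL hPint hPinv hγint isIntMatrix_coe_one
    have h2' : IsIntMatrix ((((γ' : GL (Fin 3) (w.1.adicCompletion L)))⁻¹ : GL (Fin 3) (w.1.adicCompletion L)) : Matrix (Fin 3) (Fin 3) (w.1.adicCompletion L)) := by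
      rw [hγ']
      exact isIntMatrix_coe_conj_endoGL_inv hPint hPinv (isIntMatrix_coe_inv_of_forall_v_sub_one_le_of_lt_one hlt1 hBm)
        (by rw [inv_one]; exact isIntMatrix_coe_one)
    have h := mem_unitaryInt_of_isIntMatrix γ'.2 h1 h2'
    simpa only [Subtype.coe_eta] using h
  -- the regime-B inputs: `Odd m`, `3 ≤ m`, `|disc γ₁| < |ϖ|^(2m)` (from `|disc γ₁| = |ϖ|^(2N)` and `m < N`), `|1 − 1| < |ϖ|^m`, the centre depth
  have hOdd : Odd m := ⟨k + 1, by omega⟩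
  have hdiscBγ : Valued.v ((γ₁ : Matrix (Fin 2) (Fin 2) (w.1.adicCompletion L)).trace ^ 2 - 4 * (γ₁ : Matrix (Fin 2) (Fin 2) (w.1.adicCompletion L)).det) < Valued.v ϖ ^ (2 * m) := by
    rw [hdiscγ, hϖ, ← WithZero.exp_nsmul, WithZero.exp_lt_exp]
    simp only [nsmul_eq_mul, mul_neg, mul_one, neg_lt_neg_iff]
    exact_mod_cast (show 2 * m < 2 * (2 * n + 1) by omega)
  have hdiscB : Valued.v ((((Matrix.GeneralLinearGroup.scalar (Fin 2) s * γ₁ : GL (Fin 2) (w.1.adicCompletion L)) : Matrix (Fin 2) (Fin 2) (w.1.adicCompletion L))).trace ^ 2 -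
      4 * (((Matrix.GeneralLinearGroup.scalar (Fin 2) s * γ₁ : GL (Fin 2) (w.1.adicCompletion L)) : Matrix (Fin 2) (Fin 2) (w.1.adicCompletion L))).det) < Valued.v ϖ ^ (2 * m) := by
    rw [hcoe, v_trace_sq_sub_four_mul_det_smul hsv]; exact hdiscBγ
  have hu1' : Valued.v (((1 : GL (Fin 1) (w.1.adicCompletion L)) : Matrix (Fin 1) (Fin 1) (w.1.adicCompletion L)) 0 0 - 1) < Valued.v ϖ ^ m := by
    rw [Units.val_one, Matrix.one_apply_eq, sub_self, map_zero]; exact zero_lt_iff.2 (pow_ne_zero _ ((Valuation.ne_zero_iff _).2 hϖ0))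
  have htrγ : Valued.v ((γ₁ : Matrix (Fin 2) (Fin 2) (w.1.adicCompletion L)).trace - 2 * finGammaTwo L v γH w) = Valued.v ϖ ^ m :=
    v_trace_sub_two_mul_eq_of_v_det_sub_smul_one_eq_of_disc_lt h2v _ _ (by rw [← hu00, hdet, hmm]) (by rw [← hmm]; exact hdiscBγ)
  have htr' : Valued.v ((((Matrix.GeneralLinearGroup.scalar (Fin 2) s * γ₁ : GL (Fin 2) (w.1.adicCompletion L)) : Matrix (Fin 2) (Fin 2) (w.1.adicCompletion L))).trace -
      2 * ((1 : GL (Fin 1) (w.1.adicCompletion L)) : Matrix (Fin 1) (Fin 1) (w.1.adicCompletion L)) 0 0) = Valued.v ϖ ^ m := by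
    have e : (((Matrix.GeneralLinearGroup.scalar (Fin 2) s * γ₁ : GL (Fin 2) (w.1.adicCompletion L)) : Matrix (Fin 2) (Fin 2) (w.1.adicCompletion L))).trace -
        2 * ((1 : GL (Fin 1) (w.1.adicCompletion L)) : Matrix (Fin 1) (Fin 1) (w.1.adicCompletion L)) 0 0 =
        (s : (w.1.adicCompletion L)) * (((γ₁ : Matrix (Fin 2) (Fin 2) (w.1.adicCompletion L))).trace - 2 * finGammaTwo L v γH w) := by
      rw [hcoe, Matrix.trace_smul, smul_eq_mul, Units.val_one, Matrix.one_apply_eq]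
      linear_combination (2 : (w.1.adicCompletion L)) * hs
    rw [e, map_mul, hsv, one_mul, htrγ]
  -- the grandchildren count
  have hroot2 : (stdLattice (w.1.adicCompletion L) 3).map ((Matrix.toLin' (((γ' : GL (Fin 3) (w.1.adicCompletion L)) : Matrix (Fin 3) (Fin 3) (w.1.adicCompletion L)) - 1)).restrictScalars (Valued.integer (w.1.adicCompletion L))) ≤
      scaleLattice (ϖ ^ 2) (stdLattice (w.1.adicCompletion L) 3) := by
    rw [hγ']
    exact map_sub_one_stdLattice_le_scaleLattice_of_conj_endoGL_one (pow_ne_zero _ hϖ0) hPint hPinv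
      (fun i j => (hBm i j).trans (by rw [map_pow]; exact pow_le_pow_right_of_le_one' hϖlt.le hm2))
  have hdeep2 : ∀ i j, Valued.v ((((γ' : GL (Fin 3) (w.1.adicCompletion L)) : Matrix (Fin 3) (Fin 3) (w.1.adicCompletion L)) - 1) i j) ≤ Valued.v ϖ ^ 2 := by
    have h := (map_sub_one_latt_le_scaleLattice_iff (pow_ne_zero 2 hϖ0) (γ' : GL (Fin 3) (w.1.adicCompletion L)) 1).1
      (by rw [Units.val_one, latt_one]; exact hroot2)
    intro i j
    have hij := h i j
    rw [inv_one, one_mul, mul_one, map_pow] at hij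
    exact hij
  have hGC := ncard_rootGrandchildren_eq_of_congr_sq hσσ hvσ hσϖ hϖ hres h2v hT hγ'0 hdeep2
  -- (K2-odd) REGIME-B ANISOTROPIC ROOT CENSUS at `γ′` (★ p849421, F0P2-p01 (g17)): `E = ∅`, `{P, M} = {∅, all}`
  obtain ⟨hNE, hΛ, hnΛ⟩ := anisotropicRoot_odd_census_of_coe_eq_conj_endoGL_of_nonsquare hσσ hvσ hσϖ hϖ hres h2v P₁ hform' hP0 hd hσd han₀ han₁ hση hηv hε γ'
    (Matrix.GeneralLinearGroup.scalar (Fin 2) s * γ₁) 1 hγ' hγU' hOdd hm3 hBm hu1' htr' hdiscB (1 : (w.1.adicCompletion L)) (by rw [map_one])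
  -- the total (★ p849189) with NE := 0, NP, NM := the two class counts, pooled by cases on the orientation
  have htot := anisotropicTotal_zero_ram_of_census_odd L w hw he h2 ϖ hϖ hσϖ γH hu2 m hm P₁ d η γ₁ hP₁ hform hd hσd han₀ han₁ hση hηv hγ2 hγU hχ hirrγ hηN
    k hmA s hs γ' hγ' 1 (by rw [map_one]) 0 _ _ hNE rfl rfl
  refine ⟨(Nat.card (Valued.ResidueField (w.1.adicCompletion L)) + 1) * Nat.card (Valued.ResidueField (w.1.adicCompletion L)), ?_, ?_⟩
  · rw [htot, ← hGC]
    by_cases hL : ∃ a : (w.1.adicCompletion L), Valued.v a = 1 ∧ Valued.v (((((Matrix.GeneralLinearGroup.scalar (Fin 2) s * γ₁ : GL (Fin 2) (w.1.adicCompletion L)) : Matrix (Fin 2) (Fin 2) (w.1.adicCompletion L))).trace -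
        2 * ((1 : GL (Fin 1) (w.1.adicCompletion L)) : Matrix (Fin 1) (Fin 1) (w.1.adicCompletion L)) 0 0) / (2 * ϖ ^ m) - (1 : (w.1.adicCompletion L)) * a ^ 2) < 1
    · obtain ⟨hP, hM⟩ := hΛ hL
      rw [hP, hM]; push_cast; ring
    · obtain ⟨hP, hM⟩ := hnΛ hL
      rw [hP, hM]; push_cast; ring
  · push_cast; rw [hqN]

set_option maxHeartbeats 1600000 in
-- budget only: the keeper's statement-heavy socket telescope (verbatim); the proof is a composition of ★ heads.
/-- **THE KEEPER'S CELL `stub_Zaniso_zero_even_B`, CLOSED** (regime B, row `0`, anisotropic literal, `N` even): `∀ k a, m = 2k+3 → n = a+k+1 →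
m < N → ∃ Na, (#B : ℂ) = 1 + Na·Σ_{i<k} q^{2i} ∧ Na = (q+1)·q` — ★ p849189 (this seat) ∘ ★ p849421 (F0P2-p01 (g17)) ∘ ★ p849286 at the centred literal `γ′`.
[cite: Rogawski1990, §4.9 Prop. 4.9.1 (a) p. 55, Lemma 4.9.3] [cite: Kottwitz1986, §3] [cite: BruhatTits1972, §10] -/
theorem zaniso_zero_even_B_ram
    (L : Type) [Field L] [NumberField L] [IsCMField L] (H' : Matrix (Fin 3) (Fin 3) L)
    {v : HeightOneSpectrum (𝓞 ↥(maximalRealSubfield L))}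
    (_hH' : (H'.map (cmConjRingHom L)).transpose = H') (w : PlacesOver L v)
    (hw : IsCMField.complexConj L • w.1 = w.1) (he : v.asIdeal.ramificationIdx' w.1.asIdeal ≠ 1)
    (hH'w : IsUnit (placeForm H' w.1)) (_hH'i : hH'w.unit ∈ glInt 3 (w.1.adicCompletion L))
    (h2 : IsUnit (2 : 𝒪[(w.1.adicCompletion L)]))
    (ϖ : w.1.adicCompletion L) (hϖ : Valued.v ϖ = WithZero.exp (-1 : ℤ)) (hσϖ : galAdicCompletionMap (L := L) (IsCMField.complexConj L) hw ϖ = -ϖ)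
    (A : GL (Fin 3) (w.1.adicCompletion L)) (_hA : A ∈ glInt 3 (w.1.adicCompletion L))
    (_hframe : placeForm H' w.1 = (-(placeForm H' w.1).det) • formCongr (galAdicCompletionMap (L := L) (IsCMField.complexConj L) hw) A ((StdForm.antidiagonal 3).over (w.1.adicCompletion L))) :

    ∀ ⦃γH : ((cmDatum L 2 (Matrix.of fun i j : Fin 2 => if i.val + j.val + 1 = 2 then (1 : L) else 0)).Local v × (cmDatum L 1 (Matrix.of fun i j : Fin 1 => if i.val + j.val + 1 = 1 then (1 : L) else 0)).Local v)⦄,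
      (∀ i j : Fin 2, Valued.v (((((γH.1.val : GL (Fin 2) (UnitaryGroup.LocalRing L v)).val.map (Pi.evalRingHom (fun w' : PlacesOver L v => w'.1.adicCompletion L) w))) - 1) i j) ≤ Valued.v (ϖ ^ 2)) → Valued.v (finGammaTwo L v γH w - 1) ≤ Valued.v (ϖ ^ 2) → IsLocalGRegular L v γH →
      (¬ ∃ x : (w.1.adicCompletion L), ((((γH.1.val : GL (Fin 2) (UnitaryGroup.LocalRing L v)).val.map (Pi.evalRingHom (fun w' : PlacesOver L v => w'.1.adicCompletion L) w))).charpoly).IsRoot x) → ∀ ⦃n : ℕ⦄,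
      Valued.v ((((γH.1.val : GL (Fin 2) (UnitaryGroup.LocalRing L v)).val.map (Pi.evalRingHom (fun w' : PlacesOver L v => w'.1.adicCompletion L) w))).trace ^ 2 - 4 * (((γH.1.val : GL (Fin 2) (UnitaryGroup.LocalRing L v)).val.map (Pi.evalRingHom (fun w' : PlacesOver L v => w'.1.adicCompletion L) w))).det) = WithZero.exp (-((2 * (2 * n) : ℕ) : ℤ)) → 1 ≤ n →
      ∀ (m : ℕ), Valued.v (((finCharpolyTwo L v γH).eval (finGammaTwo L v γH)) w) =
          Valued.v ((toPlace v w (HeckeCharacter.uniformizer ↥(maximalRealSubfield L) v : v.adicCompletion ↥(maximalRealSubfield L))) ^ m) →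
        ∀ β : (v.adicCompletion ↥(maximalRealSubfield L))ˣ, toPlace v w (β : v.adicCompletion ↥(maximalRealSubfield L)) =
          -(((finCharpolyTwo L v γH).eval (finGammaTwo L v γH)) w *
              (finGammaTwo L v γH w ^ 2 +
                ((γH.1.val.val : Matrix (Fin 2) (Fin 2) (LocalRing L v)).map (Pi.evalRingHom (fun w' : PlacesOver L v => w'.1.adicCompletion L) w)).det)) /
            (2 * finGammaTwo L v γH w ^ 2 *
              ((γH.1.val.val : Matrix (Fin 2) (Fin 2) (LocalRing L v)).map (Pi.evalRingHom (fun w' : PlacesOver L v => w'.1.adicCompletion L) w)).det) →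
        ∀ (P₁ : GL (Fin 3) (w.1.adicCompletion L)) (d : Fin 2 → (w.1.adicCompletion L)) (η : (w.1.adicCompletion L)) (γ₁ : GL (Fin 2) (w.1.adicCompletion L)),
        P₁ ∈ glInt 3 (w.1.adicCompletion L) →
        formCongr (galAdicCompletionMap (L := L) (IsCMField.complexConj L) hw) P₁ (placeForm (Matrix.of fun i j : Fin 3 => if i.val + j.val + 1 = 3 then (1 : L) else 0) w.1) = !![(Matrix.diagonal d) 0 0, 0, (Matrix.diagonal d) 0 1; 0, η, 0; (Matrix.diagonal d) 1 0, 0, (Matrix.diagonal d) 1 1] →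
        (∀ i, Valued.v (d i) = 1) → (∀ i, (galAdicCompletionMap (L := L) (IsCMField.complexConj L) hw) (d i) = d i) →
        (∀ z : (w.1.adicCompletion L), Valued.v z ≤ 1 → Valued.v (d 0 + d 1 * ((galAdicCompletionMap (L := L) (IsCMField.complexConj L) hw) z * z)) = 1) →
        (∀ z : (w.1.adicCompletion L), Valued.v z ≤ 1 → Valued.v (d 0 * ((galAdicCompletionMap (L := L) (IsCMField.complexConj L) hw) z * z) + d 1) = 1) →
        (galAdicCompletionMap (L := L) (IsCMField.complexConj L) hw) η = η → Valued.v η = 1 →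
        (∀ i j, Valued.v (((γ₁ : Matrix (Fin 2) (Fin 2) (w.1.adicCompletion L)) - 1) i j) ≤ Valued.v (ϖ ^ 2)) →
        γ₁ ∈ unitaryGroupOfForm (galAdicCompletionMap (L := L) (IsCMField.complexConj L) hw) (Matrix.diagonal d) →
        (γ₁ : Matrix (Fin 2) (Fin 2) (w.1.adicCompletion L)).charpoly = (((γH.1.val : GL (Fin 2) (UnitaryGroup.LocalRing L v)).val.map (Pi.evalRingHom (fun w' : PlacesOver L v => w'.1.adicCompletion L) w))).charpoly →
        Valued.v ((γ₁ : Matrix (Fin 2) (Fin 2) (w.1.adicCompletion L)).trace ^ 2 - 4 * (γ₁ : Matrix (Fin 2) (Fin 2) (w.1.adicCompletion L)).det) = WithZero.exp (-((2 * (2 * n) : ℕ) : ℤ)) →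
        (¬ ∃ x : (w.1.adicCompletion L), ((γ₁ : Matrix (Fin 2) (Fin 2) (w.1.adicCompletion L)).charpoly).IsRoot x) →
        (¬ ∃ t : (w.1.adicCompletion L), t * (galAdicCompletionMap (L := L) (IsCMField.complexConj L) hw) t = η) →
          ∀ (k a : ℕ), m = 2 * k + 3 → n = a + k + 1 → m < 2 * n → ∃ (Na : ℕ),
          ({M : Submodule (Valued.integer (w.1.adicCompletion L)) (Fin 3 → (w.1.adicCompletion L)) | IsSelfDualLattice (galAdicCompletionMap (L := L) (IsCMField.complexConj L) hw) ϖ (placeForm (Matrix.of fun i j : Fin 3 => if i.val + j.val + 1 = 3 then (1 : L) else 0) w.1) M ∧ mapGL (P₁ * endoGL (γ₁, ((localNonsplitEquiv (IsCMField.complexConj L) (Matrix.of fun i j : Fin 1 => if i.val + j.val + 1 = 1 then (1 : L) else 0) (IsCMField.complexConj_ne_one L) w hw γH.2).val : GL (Fin 1) (w.1.adicCompletion L))) * P₁⁻¹) M = M ∧ M.map ((Matrix.toLin' (((P₁ * endoGL (γ₁, ((localNonsplitEquiv (IsCMField.complexConj L) (Matrix.of fun i j : Fin 1 => if i.val + j.val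 + 1 = 1 then (1 : L) else 0) (IsCMField.complexConj_ne_one L) w hw γH.2).val : GL (Fin 1) (w.1.adicCompletion L))) * P₁⁻¹ : GL (Fin 3) (w.1.adicCompletion L)) : Matrix (Fin 3) (Fin 3) (w.1.adicCompletion L)) - 1)).restrictScalars (Valued.integer (w.1.adicCompletion L))) ≤ scaleLattice (ϖ ^ 2) M}.ncard : ℂ) =
            1 + (Na : ℂ) * ∑ i ∈ Finset.range k, (Ideal.absNorm v.asIdeal : ℂ) ^ (2 * i) ∧ (Na : ℂ) = ((Ideal.absNorm v.asIdeal : ℂ) + 1) * (Ideal.absNorm v.asIdeal : ℂ) := by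
  intro γH _hblk hu2 _hreg _hirr n _hdisc _hn m hm β _hβ P₁ d η γ₁ hP₁ hform hd hσd han₀ han₁ hση hηv hγ2 hγU hχ hdiscγ hirrγ hηN k a hmk _hna hlt
  classical
  have hmA : m = 2 * k + 3 := hmk
  -- THE CM DRESS
  have hc1 : IsCMField.complexConj L ≠ 1 := IsCMField.complexConj_ne_one L
  have h2v : Valued.v (2 : (w.1.adicCompletion L)) = 1 := (isUnit_two_integer_iff_valued_eq_one L w.1).1 h2
  have hσσ : ∀ z : (w.1.adicCompletion L), (galAdicCompletionMap (L := L) (IsCMField.complexConj L) hw) ((galAdicCompletionMap (L := L) (IsCMField.complexConj L) hw) z) = z :=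
    galAdicCompletionMap_galAdicCompletionMap_of_smul_eq (IsCMField.complexConj L) w hc1 hw
  have hvσ : ∀ z : (w.1.adicCompletion L), Valued.v ((galAdicCompletionMap (L := L) (IsCMField.complexConj L) hw) z) = Valued.v z := fun z =>
    valued_galAdicCompletionMap (L := L) (IsCMField.complexConj L) hw z
  obtain ⟨-, -, -, hres, hnorm⟩ := ramifiedBlock_adicCompletion L v w hw he h2v
  haveI : Fintype (Valued.ResidueField (w.1.adicCompletion L)) := Fintype.ofFinite _
  haveI := isPrincipalIdealRing_integer_adicCompletion L v w
  have hqN : (Nat.card (Valued.ResidueField (w.1.adicCompletion L)) : ℂ) = (Ideal.absNorm v.asIdeal : ℂ) := by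
    congr 1
    rw [← natCard_residueField_eq_of_compatible, natCard_residueField_eq_of_ramified (IsCMField.complexConj L) v hc1 w hw he, Ideal.absNorm_apply, Submodule.cardQuot_apply]
  have hsq : ∀ t : (w.1.adicCompletion L), Valued.v (t - 1) < 1 → IsSquare t := fun t ht => by
    obtain ⟨r, hr, -⟩ := exists_sq_eq_of_valued_sub_one_lt w.1 h2v t ht
    exact ⟨r, by rw [← hr, sq]⟩
  have hε := valued_sq_sub_eq_one_of_not_exists_norm hσσ hvσ hres hnorm hση hηv hηN
  have hϖ0 : ϖ ≠ 0 := fun h0 => by rw [h0, Valuation.map_zero] at hϖ; exact WithZero.exp_ne_zero hϖ.symm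
  have hϖ2 : Valued.v (ϖ ^ 2) = Valued.v ϖ ^ 2 := map_pow _ _ _
  have hϖlt : Valued.v ϖ < 1 := by rw [hϖ, ← WithZero.exp_zero]; exact WithZero.exp_lt_exp.2 (by norm_num)
  have hT := isTree_latticeGraph_three_of_neg hσσ hvσ hϖ hσϖ hres h2v hnorm
  -- the middle eigenvalue and the centring unit
  have hu00 : ((((localNonsplitEquiv (IsCMField.complexConj L) (Matrix.of fun i j : Fin 1 => if i.val + j.val + 1 = 1 then (1 : L) else 0) (IsCMField.complexConj_ne_one L) w hw γH.2).val : GL (Fin 1) (w.1.adicCompletion L))) : Matrix (Fin 1) (Fin 1) (w.1.adicCompletion L)) 0 0 = finGammaTwo L v γH w := rfl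
  obtain ⟨s, hs'⟩ := exists_units_mul_oneByOne_eq_one (((localNonsplitEquiv (IsCMField.complexConj L) (Matrix.of fun i j : Fin 1 => if i.val + j.val + 1 = 1 then (1 : L) else 0) (IsCMField.complexConj_ne_one L) w hw γH.2).val : GL (Fin 1) (w.1.adicCompletion L)))
  have hs : (s : (w.1.adicCompletion L)) * finGammaTwo L v γH w = 1 := by rw [← hu00]; exact hs'
  have huu : (galAdicCompletionMap (L := L) (IsCMField.complexConj L) hw) (finGammaTwo L v γH w) * finGammaTwo L v γH w = 1 := by
    have h := congrArg (fun y : LocalRing L v => y w) (conjLocal_finGammaTwo_mul_finGammaTwo L v γH)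
    simpa only [Pi.mul_apply, Pi.one_apply, conjLocal_apply_eq_galAdicCompletionMap L v w hw] using h
  have huv : Valued.v (finGammaTwo L v γH w) = 1 := v_eq_one_of_mul_map_eq_one hvσ (by rw [mul_comm]; exact huu)
  have hu2' : Valued.v (finGammaTwo L v γH w - 1) ≤ Valued.v ϖ ^ 2 := by rw [← hϖ2]; exact hu2
  have hsnorm : (galAdicCompletionMap (L := L) (IsCMField.complexConj L) hw) (s : (w.1.adicCompletion L)) * (s : (w.1.adicCompletion L)) = 1 :=
    norm_eq_one_of_mul_eq_one_of_norm_eq_one huu hs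
  obtain ⟨hsv, -⟩ := v_eq_one_and_v_sub_one_le_of_mul_eq_one huv hu2' hs
  -- the frame and the centred literal
  have hform' : formCongr (galAdicCompletionMap (L := L) (IsCMField.complexConj L) hw) P₁ ((StdForm.antidiagonal 3).over (w.1.adicCompletion L)) =
      !![(Matrix.diagonal d) 0 0, 0, (Matrix.diagonal d) 0 1; 0, η, 0; (Matrix.diagonal d) 1 0, 0, (Matrix.diagonal d) 1 1] := by
    rw [← placeForm_antidiagOne]; exact hform
  obtain ⟨hPint, hPinv⟩ := isIntMatrix_and_isIntMatrix_inv_of_mem_glInt hP₁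
  have hP0 : mapGL P₁ (stdLattice (w.1.adicCompletion L) 3) = stdLattice (w.1.adicCompletion L) 3 := (mapGL_stdLattice_eq_iff P₁).2 ⟨hPint, hPinv⟩
  let γ' : unitaryGroupOfForm (galAdicCompletionMap (L := L) (IsCMField.complexConj L) hw) ((StdForm.antidiagonal 3).over (w.1.adicCompletion L)) :=
    ⟨P₁ * endoGL (Matrix.GeneralLinearGroup.scalar (Fin 2) s * γ₁, (1 : GL (Fin 1) (w.1.adicCompletion L))) * P₁⁻¹,
      conj_endoGL_centred_mem_unitaryGroupOfForm_of_formCongr_eq hform' hγU s hsnorm⟩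
  have hγ' : (γ' : GL (Fin 3) (w.1.adicCompletion L)) = P₁ * endoGL (Matrix.GeneralLinearGroup.scalar (Fin 2) s * γ₁, (1 : GL (Fin 1) (w.1.adicCompletion L))) * P₁⁻¹ := rfl
  -- the block: depth `m` from the socket
  have hU : (((γ₁ : Matrix (Fin 2) (Fin 2) (w.1.adicCompletion L))).map (galAdicCompletionMap (L := L) (IsCMField.complexConj L) hw))ᵀ * Matrix.diagonal d *
      (γ₁ : Matrix (Fin 2) (Fin 2) (w.1.adicCompletion L)) = Matrix.diagonal d := hγU
  have hirr' : ∀ x : (w.1.adicCompletion L), ¬ ((γ₁ : Matrix (Fin 2) (Fin 2) (w.1.adicCompletion L)).charpoly).IsRoot x := fun x hx => hirrγ ⟨x, hx⟩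
  have hdet := valued_det_sub_smul_one_eq_of_tokens L w hw he ϖ hϖ γH m hm γ₁ hχ
  have hmm : Valued.v ϖ ^ (2 * m) = Valued.v ϖ ^ m * Valued.v ϖ ^ m := by rw [two_mul, pow_add]
  have hγd : ∀ i j, Valued.v (((γ₁ : Matrix (Fin 2) (Fin 2) (w.1.adicCompletion L)) - finGammaTwo L v γH w • (1 : Matrix (Fin 2) (Fin 2) (w.1.adicCompletion L))) i j) ≤ Valued.v ϖ ^ m :=
    forall_valued_sub_smul_one_apply_le_of_valued_det_le hvσ h2v hsq hd han₀ han₁ hU hirr' _ (by rw [← hu00, hdet, hmm])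
  have hcoe : ((Matrix.GeneralLinearGroup.scalar (Fin 2) s * γ₁ : GL (Fin 2) (w.1.adicCompletion L)) : Matrix (Fin 2) (Fin 2) (w.1.adicCompletion L)) =
      (s : (w.1.adicCompletion L)) • (γ₁ : Matrix (Fin 2) (Fin 2) (w.1.adicCompletion L)) := coe_scalar_mul_two_eq_smul s γ₁
  have hBm : ∀ i j, Valued.v ((((Matrix.GeneralLinearGroup.scalar (Fin 2) s * γ₁ : GL (Fin 2) (w.1.adicCompletion L)) : Matrix (Fin 2) (Fin 2) (w.1.adicCompletion L)) - 1) i j) ≤ Valued.v ϖ ^ m := fun i j => by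
    rw [hcoe, v_smul_sub_one_apply_eq_of_mul_eq_one _ hs hsv]; exact hγd i j
  have hγ₁int : ∀ i j, Valued.v ((γ₁ : Matrix (Fin 2) (Fin 2) (w.1.adicCompletion L)) i j) ≤ 1 :=
    isIntMatrix_of_forall_v_sub_one_le_of_lt_one (C := Valued.v (ϖ ^ 2)) (by rw [hϖ2]; exact pow_lt_one₀ zero_le hϖlt two_ne_zero) hγ2
  have hγint : ∀ i j, Valued.v (((Matrix.GeneralLinearGroup.scalar (Fin 2) s * γ₁ : GL (Fin 2) (w.1.adicCompletion L)) : Matrix (Fin 2) (Fin 2) (w.1.adicCompletion L)) i j) ≤ 1 := by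
    rw [hcoe]; exact forall_v_smul_apply_le_one hsv.le hγ₁int
  have hγU' := scalar_mul_mem_unitaryGroupOfForm hγU s hsnorm
  have hirr'' : ∀ x : (w.1.adicCompletion L), ¬ (((Matrix.GeneralLinearGroup.scalar (Fin 2) s * γ₁ : GL (Fin 2) (w.1.adicCompletion L)) : Matrix (Fin 2) (Fin 2) (w.1.adicCompletion L)).charpoly).IsRoot x := by
    rw [hcoe]; exact forall_not_isRoot_charpoly_smul (Units.ne_zero s) hirr'
  have hm3 : 3 ≤ m := by omega
  have hm2 : 2 ≤ m := by omega
  have hlt1 : Valued.v ϖ ^ m < 1 := pow_lt_one₀ zero_le hϖlt (by omega)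
  have hγ'0 : γ' ∈ unitaryInt (galAdicCompletionMap (L := L) (IsCMField.complexConj L) hw) ((StdForm.antidiagonal 3).over (w.1.adicCompletion L)) := by
    have h1 : IsIntMatrix (((γ' : GL (Fin 3) (w.1.adicCompletion L)) : Matrix (Fin 3) (Fin 3) (w.1.adicCompletion L))) := by
      rw [hγ']; exact isIntMatrix_coe_conj_endoGL hPint hPinv hγint isIntMatrix_coe_one
    have h2' : IsIntMatrix ((((γ' : GL (Fin 3) (w.1.adicCompletion L)))⁻¹ : GL (Fin 3) (w.1.adicCompletion L)) : Matrix (Fin 3) (Fin 3) (w.1.adicCompletion L)) := by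
      rw [hγ']
      exact isIntMatrix_coe_conj_endoGL_inv hPint hPinv (isIntMatrix_coe_inv_of_forall_v_sub_one_le_of_lt_one hlt1 hBm)
        (by rw [inv_one]; exact isIntMatrix_coe_one)
    have h := mem_unitaryInt_of_isIntMatrix γ'.2 h1 h2'
    simpa only [Subtype.coe_eta] using h
  -- the regime-B inputs: `Odd m`, `3 ≤ m`, `|disc γ₁| < |ϖ|^(2m)` (from `|disc γ₁| = |ϖ|^(2N)` and `m < N`), `|1 − 1| < |ϖ|^m`, the centre depth
  have hOdd : Odd m := ⟨k + 1, by omega⟩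
  have hdiscBγ : Valued.v ((γ₁ : Matrix (Fin 2) (Fin 2) (w.1.adicCompletion L)).trace ^ 2 - 4 * (γ₁ : Matrix (Fin 2) (Fin 2) (w.1.adicCompletion L)).det) < Valued.v ϖ ^ (2 * m) := by
    rw [hdiscγ, hϖ, ← WithZero.exp_nsmul, WithZero.exp_lt_exp]
    simp only [nsmul_eq_mul, mul_neg, mul_one, neg_lt_neg_iff]
    exact_mod_cast (show 2 * m < 2 * (2 * n) by omega)
  have hdiscB : Valued.v ((((Matrix.GeneralLinearGroup.scalar (Fin 2) s * γ₁ : GL (Fin 2) (w.1.adicCompletion L)) : Matrix (Fin 2) (Fin 2) (w.1.adicCompletion L))).trace ^ 2 -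
      4 * (((Matrix.GeneralLinearGroup.scalar (Fin 2) s * γ₁ : GL (Fin 2) (w.1.adicCompletion L)) : Matrix (Fin 2) (Fin 2) (w.1.adicCompletion L))).det) < Valued.v ϖ ^ (2 * m) := by
    rw [hcoe, v_trace_sq_sub_four_mul_det_smul hsv]; exact hdiscBγ
  have hu1' : Valued.v (((1 : GL (Fin 1) (w.1.adicCompletion L)) : Matrix (Fin 1) (Fin 1) (w.1.adicCompletion L)) 0 0 - 1) < Valued.v ϖ ^ m := by
    rw [Units.val_one, Matrix.one_apply_eq, sub_self, map_zero]; exact zero_lt_iff.2 (pow_ne_zero _ ((Valuation.ne_zero_iff _).2 hϖ0))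
  have htrγ : Valued.v ((γ₁ : Matrix (Fin 2) (Fin 2) (w.1.adicCompletion L)).trace - 2 * finGammaTwo L v γH w) = Valued.v ϖ ^ m :=
    v_trace_sub_two_mul_eq_of_v_det_sub_smul_one_eq_of_disc_lt h2v _ _ (by rw [← hu00, hdet, hmm]) (by rw [← hmm]; exact hdiscBγ)
  have htr' : Valued.v ((((Matrix.GeneralLinearGroup.scalar (Fin 2) s * γ₁ : GL (Fin 2) (w.1.adicCompletion L)) : Matrix (Fin 2) (Fin 2) (w.1.adicCompletion L))).trace -
      2 * ((1 : GL (Fin 1) (w.1.adicCompletion L)) : Matrix (Fin 1) (Fin 1) (w.1.adicCompletion L)) 0 0) = Valued.v ϖ ^ m := by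
    have e : (((Matrix.GeneralLinearGroup.scalar (Fin 2) s * γ₁ : GL (Fin 2) (w.1.adicCompletion L)) : Matrix (Fin 2) (Fin 2) (w.1.adicCompletion L))).trace -
        2 * ((1 : GL (Fin 1) (w.1.adicCompletion L)) : Matrix (Fin 1) (Fin 1) (w.1.adicCompletion L)) 0 0 =
        (s : (w.1.adicCompletion L)) * (((γ₁ : Matrix (Fin 2) (Fin 2) (w.1.adicCompletion L))).trace - 2 * finGammaTwo L v γH w) := by
      rw [hcoe, Matrix.trace_smul, smul_eq_mul, Units.val_one, Matrix.one_apply_eq]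
      linear_combination (2 : (w.1.adicCompletion L)) * hs
    rw [e, map_mul, hsv, one_mul, htrγ]
  -- the grandchildren count
  have hroot2 : (stdLattice (w.1.adicCompletion L) 3).map ((Matrix.toLin' (((γ' : GL (Fin 3) (w.1.adicCompletion L)) : Matrix (Fin 3) (Fin 3) (w.1.adicCompletion L)) - 1)).restrictScalars (Valued.integer (w.1.adicCompletion L))) ≤
      scaleLattice (ϖ ^ 2) (stdLattice (w.1.adicCompletion L) 3) := by
    rw [hγ']
    exact map_sub_one_stdLattice_le_scaleLattice_of_conj_endoGL_one (pow_ne_zero _ hϖ0) hPint hPinv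
      (fun i j => (hBm i j).trans (by rw [map_pow]; exact pow_le_pow_right_of_le_one' hϖlt.le hm2))
  have hdeep2 : ∀ i j, Valued.v ((((γ' : GL (Fin 3) (w.1.adicCompletion L)) : Matrix (Fin 3) (Fin 3) (w.1.adicCompletion L)) - 1) i j) ≤ Valued.v ϖ ^ 2 := by
    have h := (map_sub_one_latt_le_scaleLattice_iff (pow_ne_zero 2 hϖ0) (γ' : GL (Fin 3) (w.1.adicCompletion L)) 1).1
      (by rw [Units.val_one, latt_one]; exact hroot2)
    intro i j
    have hij := h i j
    rw [inv_one, one_mul, mul_one, map_pow] at hij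
    exact hij
  have hGC := ncard_rootGrandchildren_eq_of_congr_sq hσσ hvσ hσϖ hϖ hres h2v hT hγ'0 hdeep2
  -- (K2-odd) REGIME-B ANISOTROPIC ROOT CENSUS at `γ′` (★ p849421, F0P2-p01 (g17)): `E = ∅`, `{P, M} = {∅, all}`
  obtain ⟨hNE, hΛ, hnΛ⟩ := anisotropicRoot_odd_census_of_coe_eq_conj_endoGL_of_nonsquare hσσ hvσ hσϖ hϖ hres h2v P₁ hform' hP0 hd hσd han₀ han₁ hση hηv hε γ'
    (Matrix.GeneralLinearGroup.scalar (Fin 2) s * γ₁) 1 hγ' hγU' hOdd hm3 hBm hu1' htr' hdiscB (1 : (w.1.adicCompletion L)) (by rw [map_one])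
  -- the total (★ p849189) with NE := 0, NP, NM := the two class counts, pooled by cases on the orientation
  have htot := anisotropicTotal_zero_ram_of_census_odd L w hw he h2 ϖ hϖ hσϖ γH hu2 m hm P₁ d η γ₁ hP₁ hform hd hσd han₀ han₁ hση hηv hγ2 hγU hχ hirrγ hηN
    k hmA s hs γ' hγ' 1 (by rw [map_one]) 0 _ _ hNE rfl rfl
  refine ⟨(Nat.card (Valued.ResidueField (w.1.adicCompletion L)) + 1) * Nat.card (Valued.ResidueField (w.1.adicCompletion L)), ?_, ?_⟩
  · rw [htot, ← hGC]
    by_cases hL : ∃ a : (w.1.adicCompletion L), Valued.v a = 1 ∧ Valued.v (((((Matrix.GeneralLinearGroup.scalar (Fin 2) s * γ₁ : GL (Fin 2) (w.1.adicCompletion L)) : Matrix (Fin 2) (Fin 2) (w.1.adicCompletion L))).trace -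
        2 * ((1 : GL (Fin 1) (w.1.adicCompletion L)) : Matrix (Fin 1) (Fin 1) (w.1.adicCompletion L)) 0 0) / (2 * ϖ ^ m) - (1 : (w.1.adicCompletion L)) * a ^ 2) < 1
    · obtain ⟨hP, hM⟩ := hΛ hL
      rw [hP, hM]; push_cast; ring
    · obtain ⟨hP, hM⟩ := hnΛ hL
      rw [hP, hM]; push_cast; ring
  · push_cast; rw [hqN]

end Literature.NumberTheory.Rogawski1990.BlockLawAniso

end
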